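import Mathlib
import HarnessLib
import Summits.ValiantsHypothesis.ValiantsHypothesis.Theorems.LacunarySymmetroidMatrixDescartesOsculationLawTwoK

/-!
# ValiantsHypothesis / LacunarySymmetroid — crux `MatrixDescartes` (stmt-ValiantsHypothesis-18050, V1),
# line `Cruxes/MatrixDescartes/Lines/osculation_law.lean` («osculation-law»): the splitting `(r,s) = (3,0)` of the
# `m = 3` rung — symmetric `3 × 3` pencils with the FULL-RANK letter inserted: pencil lemmas

File 4/5 of the `(3,0)` piece (pencil bookkeeping; the count `osc_three_zero` is in `…ThreeKThreeZero`).  For a symmetric block pencil `G(t) = Σ_l t^(d l) S_l` on `Fin 3 ⊕ Fin 0` and the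
block projector `I₃ ⊕ 0 = 1`, the insertion polynomial is the MONIC CUBIC `Φ = det(G(t) + b·I₃) = b³ + σ₁b² + σ₂b + σ₃`
(`σ₁ = tr G`, `σ₂` = sum of the principal `2 × 2` minors, `σ₃ = det G`; `insertionPoly_three_zero`).  The two
analytic inputs of the abstract count `OsculationCuspCubic.cubic_curve_ncard_le` are discharged from the matrix
picture: REAL-ROOTEDNESS (`hreal_three_zero`: `Φ(t,b) = ∏ᵢ (b − μᵢ(t))` with `μᵢ(t)` the eigenvalues of the
symmetric matrix `−G(t)`, Mathlib `Matrix.IsHermitian.charpoly_eq` + `Matrix.eval_charpoly`) and ROOT PERSISTENCE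
(`persist_three_zero`: a positive root `b₀` of `Φ(t₀,·)` is a kernel vector `v` of `G(t₀) + b₀I`, so
`vᵀG(t₀)v < 0`; this open condition persists for `t` near `t₀`, where `G(t)` is then not positive semidefinite, has a
negative eigenvalue `λ` (`IsHermitian.posSemidef_iff_eigenvalues_nonneg`), and `b = −λ > 0` is a root of `Φ(t,·)` by the
eigenvector).  With the monomial supports `supp σᵢ ⊆ i • E` (`E` = the exponent set, `|E| ≤ K`):

* **`osc_three_zero`** — for every `K`, `d`, symmetric `S : Fin K → Matrix (Fin 3 ⊕ Fin 0) (Fin 3 ⊕ Fin 0) ℝ`, a finite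
  osculation set of the spectral curve has at most `17 · K ^ 41` points (the line's `OsculationLawAt 3 K ·`, splitting
  `r = 3, s = 0`, vocabulary UNFOLDED verbatim as in `OsculationTwoK.osc_two_zero`).

The `(0,3)`, `(1,2)` splittings are `OsculationLawRankZero/RankOne`-type theorems already in the tree and `(2,1)` is
val-lit-p5 g11's; the assembly `osculationLawAt_three` is theirs.  Honest framing: a located rung piece of an
UNREGISTERED V1 law line (ideator val-idea-2); `OsculationLaw` (all `m`), `PeelInequality`, `stub_recursion`,
`MatrixDescartes`, Conjecture B and `VP ≠ VNP` are OPEN / NOT proved; nothing here is progress on them; census +0.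
No definitions, no named facts; Mathlib + the line's files only.
-/

-- `Summit.ValiantsHypothesis.ValiantsHypothesis.…` is the tree's mandated single-conjunct layout (Sub = Summit).
set_option linter.dupNamespace false

noncomputable section

namespace Summit.ValiantsHypothesis.ValiantsHypothesis.Theorems.LacunarySymmetroidMatrixDescartes

open Polynomial Set
open scoped BigOperators Matrix Pointwise

namespace OsculationThreeK

/-! ### `3 × 3` bookkeeping on `Fin 3 ⊕ Fin 0` -/

/-- `I₃ ⊕ 0 = 1` on `Fin 3 ⊕ Fin 0`. [folklore] -/
theorem blockProj_three_zero : (Matrix.fromBlocks 1 0 0 0 : Matrix (Fin 3 ⊕ Fin 0) (Fin 3 ⊕ Fin 0) ℝ) = 1 := by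
  rw [show (0 : Matrix (Fin 0) (Fin 0) ℝ) = 1 from Subsingleton.elim _ _, Matrix.fromBlocks_one]

/-- A `3 × 3` determinant on `Fin 3 ⊕ Fin 0` (Sarrus, indices `inl`). [folklore] -/
theorem det_three_zero {R : Type*} [CommRing R] (N : Matrix (Fin 3 ⊕ Fin 0) (Fin 3 ⊕ Fin 0) R) :
    N.det = N (Sum.inl 0) (Sum.inl 0) * N (Sum.inl 1) (Sum.inl 1) * N (Sum.inl 2) (Sum.inl 2)
      - N (Sum.inl 0) (Sum.inl 0) * N (Sum.inl 1) (Sum.inl 2) * N (Sum.inl 2) (Sum.inl 1)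
      - N (Sum.inl 0) (Sum.inl 1) * N (Sum.inl 1) (Sum.inl 0) * N (Sum.inl 2) (Sum.inl 2)
      + N (Sum.inl 0) (Sum.inl 1) * N (Sum.inl 1) (Sum.inl 2) * N (Sum.inl 2) (Sum.inl 0)
      + N (Sum.inl 0) (Sum.inl 2) * N (Sum.inl 1) (Sum.inl 0) * N (Sum.inl 2) (Sum.inl 1)
      - N (Sum.inl 0) (Sum.inl 2) * N (Sum.inl 1) (Sum.inl 1) * N (Sum.inl 2) (Sum.inl 0) := by
  rw [← Matrix.det_reindex_self (Equiv.sumEmpty (Fin 3) (Fin 0)) N, Matrix.det_fin_three]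
  simp [Matrix.reindex_apply, Matrix.submatrix_apply, Equiv.sumEmpty_symm_apply]

/-- At `(3,0)` the insertion polynomial is the monic cubic `X₁³ + X₁²·ι σ₁ + X₁·ι σ₂ + ι σ₃` with `σ₁ = tr G`,
`σ₂ = Σ` principal `2 × 2` minors, `σ₃ = det G`. [folklore] -/
theorem insertionPoly_three_zero (K : ℕ) (d : Fin K → ℕ) (S : Fin K → Matrix (Fin 3 ⊕ Fin 0) (Fin 3 ⊕ Fin 0) ℝ) :
    (∑ l, (MvPolynomial.X (0 : Fin 2) : MvPolynomial (Fin 2) ℝ) ^ d l •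
              (S l).map (MvPolynomial.C : ℝ →+* MvPolynomial (Fin 2) ℝ)
            + (MvPolynomial.X (1 : Fin 2) : MvPolynomial (Fin 2) ℝ) •
              (Matrix.fromBlocks 1 0 0 0 : Matrix (Fin 3 ⊕ Fin 0) (Fin 3 ⊕ Fin 0) ℝ).map
                (MvPolynomial.C : ℝ →+* MvPolynomial (Fin 2) ℝ)).det =
      MvPolynomial.X 1 * MvPolynomial.X 1 * MvPolynomial.X 1
        + MvPolynomial.X 1 * MvPolynomial.X 1 * Polynomial.aeval (MvPolynomial.X 0 : MvPolynomial (Fin 2) ℝ) ((∑ l, (X : ℝ[X]) ^ d l • (S l).map Polynomial.C) (Sum.inl 0) (Sum.inl 0) + (∑ l, (X : ℝ[X]) ^ d l • (S l).map Polynomial.C) (Sum.inl 1) (Sum.inl 1) + (∑ l, (X : ℝ[X]) ^ d l • (S l).map Polynomial.C) (Sum.inl 2) (Sum.inl 2))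
        + MvPolynomial.X 1 * Polynomial.aeval (MvPolynomial.X 0 : MvPolynomial (Fin 2) ℝ) ((∑ l, (X : ℝ[X]) ^ d l • (S l).map Polynomial.C) (Sum.inl 0) (Sum.inl 0) * (∑ l, (X : ℝ[X]) ^ d l • (S l).map Polynomial.C) (Sum.inl 1) (Sum.inl 1) - (∑ l, (X : ℝ[X]) ^ d l • (S l).map Polynomial.C) (Sum.inl 0) (Sum.inl 1) * (∑ l, (X : ℝ[X]) ^ d l • (S l).map Polynomial.C) (Sum.inl 1) (Sum.inl 0) + (∑ l, (X : ℝ[X]) ^ d l • (S l).map Polynomial.C) (Sum.inl 0) (Sum.inl 0) * (∑ l, (X : ℝ[X]) ^ d l • (S l).map Polynomial.C) (Sum.inl 2) (Sum.inl 2) - (∑ l, (X : ℝ[X]) ^ d l • (S l).map Polynomial.C) (Sum.inl 0) (Sum.inl 2) * (∑ l, (X : ℝ[X]) ^ d l • (S l).map Polynomial.C) (Sum.inl 2) (Sum.inl 0) + (∑ l, (X : ℝ[X]) ^ d l • (S l).map Polynomial.C) (Sum.inl 1) (Sum.inl 1) * (∑ l, (X : ℝ[X]) ^ d l • (S l).map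 Polynomial.C) (Sum.inl 2) (Sum.inl 2) - (∑ l, (X : ℝ[X]) ^ d l • (S l).map Polynomial.C) (Sum.inl 1) (Sum.inl 2) * (∑ l, (X : ℝ[X]) ^ d l • (S l).map Polynomial.C) (Sum.inl 2) (Sum.inl 1))
        + Polynomial.aeval (MvPolynomial.X 0 : MvPolynomial (Fin 2) ℝ) ((∑ l, (X : ℝ[X]) ^ d l • (S l).map Polynomial.C) (Sum.inl 0) (Sum.inl 0) * (∑ l, (X : ℝ[X]) ^ d l • (S l).map Polynomial.C) (Sum.inl 1) (Sum.inl 1) * (∑ l, (X : ℝ[X]) ^ d l • (S l).map Polynomial.C) (Sum.inl 2) (Sum.inl 2) - (∑ l, (X : ℝ[X]) ^ d l • (S l).map Polynomial.C) (Sum.inl 0) (Sum.inl 0) * (∑ l, (X : ℝ[X]) ^ d l • (S l).map Polynomial.C) (Sum.inl 1) (Sum.inl 2) * (∑ l, (X : ℝ[X]) ^ d l • (S l).map Polynomial.C) (Sum.inl 2) (Sum.inl 1) - (∑ l, (X : ℝ[X]) ^ d l • (S l).map Polynomial.C) (Sum.inl 0) (Sum.inl 1) * (∑ l, (X : ℝ[X])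 ^ d l • (S l).map Polynomial.C) (Sum.inl 1) (Sum.inl 0) * (∑ l, (X : ℝ[X]) ^ d l • (S l).map Polynomial.C) (Sum.inl 2) (Sum.inl 2) + (∑ l, (X : ℝ[X]) ^ d l • (S l).map Polynomial.C) (Sum.inl 0) (Sum.inl 1) * (∑ l, (X : ℝ[X]) ^ d l • (S l).map Polynomial.C) (Sum.inl 1) (Sum.inl 2) * (∑ l, (X : ℝ[X]) ^ d l • (S l).map Polynomial.C) (Sum.inl 2) (Sum.inl 0) + (∑ l, (X : ℝ[X]) ^ d l • (S l).map Polynomial.C) (Sum.inl 0) (Sum.inl 2) * (∑ l, (X : ℝ[X]) ^ d l • (S l).map Polynomial.C) (Sum.inl 1) (Sum.inl 0) * (∑ l, (X : ℝ[X]) ^ d l • (S l).map Polynomial.C) (Sum.inl 2) (Sum.inl 1) - (∑ l, (X : ℝ[X]) ^ d l • (S l).map Polynomial.C) (Sum.inl 0) (Sum.inl 2) * (∑ l, (X : ℝ[X]) ^ d l • (S l).map Polynomial.C) (Sum.inl 1) (Sum.inl 1) * (∑ l, (X : ℝ[X]) ^ d l • (S l).map Polynomial.C) (Sum.inl 2)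 (Sum.inl 0)) := by
  rw [blockProj_three_zero, Matrix.map_one _ (map_zero _) (map_one _), det_three_zero,
    ← OsculationTwoK.map_aevalX0_pencil_gen]
  simp only [Matrix.add_apply, Matrix.smul_apply, Matrix.map_apply, Matrix.one_apply_eq,
    Matrix.one_apply_ne (show (Sum.inl 0 : Fin 3 ⊕ Fin 0) ≠ Sum.inl 1 by decide),
    Matrix.one_apply_ne (show (Sum.inl 0 : Fin 3 ⊕ Fin 0) ≠ Sum.inl 2 by decide),
    Matrix.one_apply_ne (show (Sum.inl 1 : Fin 3 ⊕ Fin 0) ≠ Sum.inl 0 by decide),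
    Matrix.one_apply_ne (show (Sum.inl 1 : Fin 3 ⊕ Fin 0) ≠ Sum.inl 2 by decide),
    Matrix.one_apply_ne (show (Sum.inl 2 : Fin 3 ⊕ Fin 0) ≠ Sum.inl 0 by decide),
    Matrix.one_apply_ne (show (Sum.inl 2 : Fin 3 ⊕ Fin 0) ≠ Sum.inl 1 by decide),
    smul_eq_mul, mul_one, mul_zero, add_zero, map_add, map_sub, map_mul]
  ring

/-- An entry of the pencil, evaluated at `t`, is the entry of the real matrix `G(t) = Σ_l t^(d l) S_l`. [folklore] -/
theorem eval_pencil_apply (K : ℕ) (d : Fin K → ℕ) (S : Fin K → Matrix (Fin 3 ⊕ Fin 0) (Fin 3 ⊕ Fin 0) ℝ)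
    (i j : Fin 3 ⊕ Fin 0) (t : ℝ) :
    ((∑ l, (X : ℝ[X]) ^ d l • (S l).map Polynomial.C) i j).eval t = (∑ l, t ^ d l • S l) i j := by
  rw [OsculationTwoK.pencil_apply]
  simp only [eval_finsetSum, eval_mul, eval_C, eval_pow, eval_X, Matrix.sum_apply, Matrix.smul_apply, smul_eq_mul]
  exact Finset.sum_congr rfl fun l _ => mul_comm _ _

/-- The monic cubic is `det(G(t) + b·1)`. [folklore] -/
theorem cubic_eq_det (K : ℕ) (d : Fin K → ℕ) (S : Fin K → Matrix (Fin 3 ⊕ Fin 0) (Fin 3 ⊕ Fin 0) ℝ) (t b : ℝ) :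
    b ^ 3 + b ^ 2 * ((∑ l, (X : ℝ[X]) ^ d l • (S l).map Polynomial.C) (Sum.inl 0) (Sum.inl 0) + (∑ l, (X : ℝ[X]) ^ d l • (S l).map Polynomial.C) (Sum.inl 1) (Sum.inl 1) + (∑ l, (X : ℝ[X]) ^ d l • (S l).map Polynomial.C) (Sum.inl 2) (Sum.inl 2)).eval t + b * ((∑ l, (X : ℝ[X]) ^ d l • (S l).map Polynomial.C) (Sum.inl 0) (Sum.inl 0) * (∑ l, (X : ℝ[X]) ^ d l • (S l).map Polynomial.C) (Sum.inl 1) (Sum.inl 1) - (∑ l, (X : ℝ[X]) ^ d l • (S l).map Polynomial.C) (Sum.inl 0) (Sum.inl 1) * (∑ l, (X : ℝ[X]) ^ d l • (S l).map Polynomial.C) (Sum.inl 1) (Sum.inl 0) + (∑ l, (X : ℝ[X]) ^ d l • (S l).map Polynomial.C) (Sum.inl 0) (Sum.inl 0) * (∑ l, (X : ℝ[X]) ^ d l • (S l).map Polynomial.C) (Sum.inl 2) (Sum.inl 2) - (∑ l, (X : ℝ[X]) ^ d l • (S l).map Polynomial.C) (Sum.inl 0) (Sum.inl 2) * (∑ l,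 (X : ℝ[X]) ^ d l • (S l).map Polynomial.C) (Sum.inl 2) (Sum.inl 0) + (∑ l, (X : ℝ[X]) ^ d l • (S l).map Polynomial.C) (Sum.inl 1) (Sum.inl 1) * (∑ l, (X : ℝ[X]) ^ d l • (S l).map Polynomial.C) (Sum.inl 2) (Sum.inl 2) - (∑ l, (X : ℝ[X]) ^ d l • (S l).map Polynomial.C) (Sum.inl 1) (Sum.inl 2) * (∑ l, (X : ℝ[X]) ^ d l • (S l).map Polynomial.C) (Sum.inl 2) (Sum.inl 1)).eval t + ((∑ l, (X : ℝ[X]) ^ d l • (S l).map Polynomial.C) (Sum.inl 0) (Sum.inl 0) * (∑ l, (X : ℝ[X]) ^ d l • (S l).map Polynomial.C) (Sum.inl 1) (Sum.inl 1) * (∑ l, (X : ℝ[X]) ^ d l • (S l).map Polynomial.C) (Sum.inl 2) (Sum.inl 2) - (∑ l, (X : ℝ[X]) ^ d l • (S l).map Polynomial.C) (Sum.inl 0) (Sum.inl 0) * (∑ l, (X : ℝ[X]) ^ d l • (S l).map Polynomial.C) (Sum.inl 1) (Sum.inl 2) * (∑ l, (X : ℝ[X]) ^ d l • (S l).map Polynomial.C)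 (Sum.inl 2) (Sum.inl 1) - (∑ l, (X : ℝ[X]) ^ d l • (S l).map Polynomial.C) (Sum.inl 0) (Sum.inl 1) * (∑ l, (X : ℝ[X]) ^ d l • (S l).map Polynomial.C) (Sum.inl 1) (Sum.inl 0) * (∑ l, (X : ℝ[X]) ^ d l • (S l).map Polynomial.C) (Sum.inl 2) (Sum.inl 2) + (∑ l, (X : ℝ[X]) ^ d l • (S l).map Polynomial.C) (Sum.inl 0) (Sum.inl 1) * (∑ l, (X : ℝ[X]) ^ d l • (S l).map Polynomial.C) (Sum.inl 1) (Sum.inl 2) * (∑ l, (X : ℝ[X]) ^ d l • (S l).map Polynomial.C) (Sum.inl 2) (Sum.inl 0) + (∑ l, (X : ℝ[X]) ^ d l • (S l).map Polynomial.C) (Sum.inl 0) (Sum.inl 2) * (∑ l, (X : ℝ[X]) ^ d l • (S l).map Polynomial.C) (Sum.inl 1) (Sum.inl 0) * (∑ l, (X : ℝ[X]) ^ d l • (S l).map Polynomial.C) (Sum.inl 2) (Sum.inl 1) - (∑ l, (X : ℝ[X]) ^ d l • (S l).map Polynomial.C) (Sum.inl 0) (Sum.inl 2) * (∑ l, (X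 : ℝ[X]) ^ d l • (S l).map Polynomial.C) (Sum.inl 1) (Sum.inl 1) * (∑ l, (X : ℝ[X]) ^ d l • (S l).map Polynomial.C) (Sum.inl 2) (Sum.inl 0)).eval t =
      ((∑ l, t ^ d l • S l) + b • (1 : Matrix (Fin 3 ⊕ Fin 0) (Fin 3 ⊕ Fin 0) ℝ)).det := by
  rw [det_three_zero]
  simp only [eval_add, eval_sub, eval_mul, eval_pencil_apply, Matrix.add_apply, Matrix.smul_apply,
    Matrix.one_apply_eq,
    Matrix.one_apply_ne (show (Sum.inl 0 : Fin 3 ⊕ Fin 0) ≠ Sum.inl 1 by decide),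
    Matrix.one_apply_ne (show (Sum.inl 0 : Fin 3 ⊕ Fin 0) ≠ Sum.inl 2 by decide),
    Matrix.one_apply_ne (show (Sum.inl 1 : Fin 3 ⊕ Fin 0) ≠ Sum.inl 0 by decide),
    Matrix.one_apply_ne (show (Sum.inl 1 : Fin 3 ⊕ Fin 0) ≠ Sum.inl 2 by decide),
    Matrix.one_apply_ne (show (Sum.inl 2 : Fin 3 ⊕ Fin 0) ≠ Sum.inl 0 by decide),
    Matrix.one_apply_ne (show (Sum.inl 2 : Fin 3 ⊕ Fin 0) ≠ Sum.inl 1 by decide),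
    smul_eq_mul, mul_one, mul_zero, add_zero]
  ring

/-- `G(t)` is symmetric. [folklore] -/
theorem isSymm_pencil (K : ℕ) (d : Fin K → ℕ) (S : Fin K → Matrix (Fin 3 ⊕ Fin 0) (Fin 3 ⊕ Fin 0) ℝ)
    (hS : ∀ l, (S l).IsSymm) (t : ℝ) : (∑ l, t ^ d l • S l).IsSymm := by
  refine Matrix.IsSymm.ext fun i j => ?_
  simp only [Matrix.sum_apply, Matrix.smul_apply, smul_eq_mul]
  exact Finset.sum_congr rfl fun l _ => by rw [(hS l).apply i j]

/-- **Real-rootedness**: `Φ(t, b) = ∏ᵢ (b − μᵢ(t))`, `μᵢ(t)` the eigenvalues of the symmetric matrix `−G(t)`. [folklore] -/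
theorem hreal_three_zero (K : ℕ) (d : Fin K → ℕ) (S : Fin K → Matrix (Fin 3 ⊕ Fin 0) (Fin 3 ⊕ Fin 0) ℝ)
    (hS : ∀ l, (S l).IsSymm) (t : ℝ) :
    ∃ μ₁ μ₂ μ₃ : ℝ, ∀ b : ℝ,
      b ^ 3 + b ^ 2 * ((∑ l, (X : ℝ[X]) ^ d l • (S l).map Polynomial.C) (Sum.inl 0) (Sum.inl 0) + (∑ l, (X : ℝ[X]) ^ d l • (S l).map Polynomial.C) (Sum.inl 1) (Sum.inl 1) + (∑ l, (X : ℝ[X]) ^ d l • (S l).map Polynomial.C) (Sum.inl 2) (Sum.inl 2)).eval t + b * ((∑ l, (X : ℝ[X]) ^ d l • (S l).map Polynomial.C) (Sum.inl 0) (Sum.inl 0) * (∑ l, (X : ℝ[X]) ^ d l • (S l).map Polynomial.C) (Sum.inl 1) (Sum.inl 1) - (∑ l, (X : ℝ[X]) ^ d l • (S l).map Polynomial.C) (Sum.inl 0) (Sum.inl 1) * (∑ l, (X : ℝ[X]) ^ d l • (S l).map Polynomial.C) (Sum.inl 1) (Sum.inl 0) + (∑ l, (X : ℝ[X]) ^ d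 l • (S l).map Polynomial.C) (Sum.inl 0) (Sum.inl 0) * (∑ l, (X : ℝ[X]) ^ d l • (S l).map Polynomial.C) (Sum.inl 2) (Sum.inl 2) - (∑ l, (X : ℝ[X]) ^ d l • (S l).map Polynomial.C) (Sum.inl 0) (Sum.inl 2) * (∑ l, (X : ℝ[X]) ^ d l • (S l).map Polynomial.C) (Sum.inl 2) (Sum.inl 0) + (∑ l, (X : ℝ[X]) ^ d l • (S l).map Polynomial.C) (Sum.inl 1) (Sum.inl 1) * (∑ l, (X : ℝ[X]) ^ d l • (S l).map Polynomial.C) (Sum.inl 2) (Sum.inl 2) - (∑ l, (X : ℝ[X]) ^ d l • (S l).map Polynomial.C) (Sum.inl 1) (Sum.inl 2) * (∑ l, (X : ℝ[X]) ^ d l • (S l).map Polynomial.C) (Sum.inl 2) (Sum.inl 1)).eval t + ((∑ l, (X : ℝ[X]) ^ d l • (S l).map Polynomial.C) (Sum.inl 0) (Sum.inl 0) * (∑ l, (X : ℝ[X]) ^ d l • (S l).map Polynomial.C) (Sum.inl 1) (Sum.inl 1) * (∑ l, (X : ℝ[X]) ^ d l • (S l).map Polynomial.C) (Sum.inl 2)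 (Sum.inl 2) - (∑ l, (X : ℝ[X]) ^ d l • (S l).map Polynomial.C) (Sum.inl 0) (Sum.inl 0) * (∑ l, (X : ℝ[X]) ^ d l • (S l).map Polynomial.C) (Sum.inl 1) (Sum.inl 2) * (∑ l, (X : ℝ[X]) ^ d l • (S l).map Polynomial.C) (Sum.inl 2) (Sum.inl 1) - (∑ l, (X : ℝ[X]) ^ d l • (S l).map Polynomial.C) (Sum.inl 0) (Sum.inl 1) * (∑ l, (X : ℝ[X]) ^ d l • (S l).map Polynomial.C) (Sum.inl 1) (Sum.inl 0) * (∑ l, (X : ℝ[X]) ^ d l • (S l).map Polynomial.C) (Sum.inl 2) (Sum.inl 2) + (∑ l, (X : ℝ[X]) ^ d l • (S l).map Polynomial.C) (Sum.inl 0) (Sum.inl 1) * (∑ l, (X : ℝ[X]) ^ d l • (S l).map Polynomial.C) (Sum.inl 1) (Sum.inl 2) * (∑ l, (X : ℝ[X]) ^ d l • (S l).map Polynomial.C) (Sum.inl 2) (Sum.inl 0) + (∑ l, (X : ℝ[X]) ^ d l • (S l).map Polynomial.C) (Sum.inl 0) (Sum.inl 2) * (∑ l, (X : ℝ[X]) ^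 d l • (S l).map Polynomial.C) (Sum.inl 1) (Sum.inl 0) * (∑ l, (X : ℝ[X]) ^ d l • (S l).map Polynomial.C) (Sum.inl 2) (Sum.inl 1) - (∑ l, (X : ℝ[X]) ^ d l • (S l).map Polynomial.C) (Sum.inl 0) (Sum.inl 2) * (∑ l, (X : ℝ[X]) ^ d l • (S l).map Polynomial.C) (Sum.inl 1) (Sum.inl 1) * (∑ l, (X : ℝ[X]) ^ d l • (S l).map Polynomial.C) (Sum.inl 2) (Sum.inl 0)).eval t = (b - μ₁) * (b - μ₂) * (b - μ₃) := by
  classical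
  set M : Matrix (Fin 3 ⊕ Fin 0) (Fin 3 ⊕ Fin 0) ℝ := ∑ l, t ^ d l • S l with hM
  have hH : (-M).IsHermitian := (Matrix.isHermitian_iff_isSymm.2 (isSymm_pencil K d S hS t)).neg
  refine ⟨hH.eigenvalues (Sum.inl 0), hH.eigenvalues (Sum.inl 1), hH.eigenvalues (Sum.inl 2), fun b => ?_⟩
  rw [cubic_eq_det]
  have h1 : M + b • (1 : Matrix (Fin 3 ⊕ Fin 0) (Fin 3 ⊕ Fin 0) ℝ) = Matrix.scalar (Fin 3 ⊕ Fin 0) b - (-M) := by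
    rw [Matrix.scalar_apply, ← Matrix.smul_one_eq_diagonal, sub_neg_eq_add, add_comm]
  rw [h1, ← Matrix.eval_charpoly, hH.charpoly_eq, Polynomial.eval_prod]
  simp only [eval_sub, eval_X, eval_C, Fintype.prod_sum_type, Fin.prod_univ_three, Finset.univ_eq_empty,
    Finset.prod_empty, mul_one, RCLike.ofReal_real_eq_id, id_eq]

/-- **Root persistence**: a positive root of `Φ(t₀,·) = det(G(t₀) + b·1)` propagates to positive roots of `Φ(t,·)` for
`t` near `t₀` (a negative eigenvalue of the symmetric matrix `G(t)` persists). [folklore] -/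
theorem persist_three_zero (K : ℕ) (d : Fin K → ℕ) (S : Fin K → Matrix (Fin 3 ⊕ Fin 0) (Fin 3 ⊕ Fin 0) ℝ)
    (hS : ∀ l, (S l).IsSymm) (t₀ b₀ : ℝ) (hb₀ : 0 < b₀)
    (hroot : b₀ ^ 3 + b₀ ^ 2 * ((∑ l, (X : ℝ[X]) ^ d l • (S l).map Polynomial.C) (Sum.inl 0) (Sum.inl 0) + (∑ l, (X : ℝ[X]) ^ d l • (S l).map Polynomial.C) (Sum.inl 1) (Sum.inl 1) + (∑ l, (X : ℝ[X]) ^ d l • (S l).map Polynomial.C) (Sum.inl 2) (Sum.inl 2)).eval t₀ + b₀ * ((∑ l, (X : ℝ[X]) ^ d l • (S l).map Polynomial.C) (Sum.inl 0) (Sum.inl 0) * (∑ l, (X : ℝ[X]) ^ d l • (S l).map Polynomial.C) (Sum.inl 1) (Sum.inl 1) - (∑ l, (X : ℝ[X]) ^ d l • (S l).map Polynomial.C) (Sum.inl 0) (Sum.inl 1) * (∑ l, (X : ℝ[X]) ^ d l • (S l).map Polynomial.C) (Sum.inl 1) (Sum.inl 0) + (∑ l, (X : ℝ[X]) ^ d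 l • (S l).map Polynomial.C) (Sum.inl 0) (Sum.inl 0) * (∑ l, (X : ℝ[X]) ^ d l • (S l).map Polynomial.C) (Sum.inl 2) (Sum.inl 2) - (∑ l, (X : ℝ[X]) ^ d l • (S l).map Polynomial.C) (Sum.inl 0) (Sum.inl 2) * (∑ l, (X : ℝ[X]) ^ d l • (S l).map Polynomial.C) (Sum.inl 2) (Sum.inl 0) + (∑ l, (X : ℝ[X]) ^ d l • (S l).map Polynomial.C) (Sum.inl 1) (Sum.inl 1) * (∑ l, (X : ℝ[X]) ^ d l • (S l).map Polynomial.C) (Sum.inl 2) (Sum.inl 2) - (∑ l, (X : ℝ[X]) ^ d l • (S l).map Polynomial.C) (Sum.inl 1) (Sum.inl 2) * (∑ l, (X : ℝ[X]) ^ d l • (S l).map Polynomial.C) (Sum.inl 2) (Sum.inl 1)).eval t₀ + ((∑ l, (X : ℝ[X]) ^ d l • (S l).map Polynomial.C) (Sum.inl 0) (Sum.inl 0) * (∑ l, (X : ℝ[X]) ^ d l • (S l).map Polynomial.C) (Sum.inl 1) (Sum.inl 1) * (∑ l, (X : ℝ[X]) ^ d l • (S l).map Polynomial.C) (Sum.inl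 2) (Sum.inl 2) - (∑ l, (X : ℝ[X]) ^ d l • (S l).map Polynomial.C) (Sum.inl 0) (Sum.inl 0) * (∑ l, (X : ℝ[X]) ^ d l • (S l).map Polynomial.C) (Sum.inl 1) (Sum.inl 2) * (∑ l, (X : ℝ[X]) ^ d l • (S l).map Polynomial.C) (Sum.inl 2) (Sum.inl 1) - (∑ l, (X : ℝ[X]) ^ d l • (S l).map Polynomial.C) (Sum.inl 0) (Sum.inl 1) * (∑ l, (X : ℝ[X]) ^ d l • (S l).map Polynomial.C) (Sum.inl 1) (Sum.inl 0) * (∑ l, (X : ℝ[X]) ^ d l • (S l).map Polynomial.C) (Sum.inl 2) (Sum.inl 2) + (∑ l, (X : ℝ[X]) ^ d l • (S l).map Polynomial.C) (Sum.inl 0) (Sum.inl 1) * (∑ l, (X : ℝ[X]) ^ d l • (S l).map Polynomial.C) (Sum.inl 1) (Sum.inl 2) * (∑ l, (X : ℝ[X]) ^ d l • (S l).map Polynomial.C) (Sum.inl 2) (Sum.inl 0) + (∑ l, (X : ℝ[X]) ^ d l • (S l).map Polynomial.C) (Sum.inl 0) (Sum.inl 2) * (∑ l, (X : ℝ[X])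 ^ d l • (S l).map Polynomial.C) (Sum.inl 1) (Sum.inl 0) * (∑ l, (X : ℝ[X]) ^ d l • (S l).map Polynomial.C) (Sum.inl 2) (Sum.inl 1) - (∑ l, (X : ℝ[X]) ^ d l • (S l).map Polynomial.C) (Sum.inl 0) (Sum.inl 2) * (∑ l, (X : ℝ[X]) ^ d l • (S l).map Polynomial.C) (Sum.inl 1) (Sum.inl 1) * (∑ l, (X : ℝ[X]) ^ d l • (S l).map Polynomial.C) (Sum.inl 2) (Sum.inl 0)).eval t₀ = 0) :
    ∃ U : Set ℝ, IsOpen U ∧ t₀ ∈ U ∧ ∃ γ : ℝ → ℝ, ∀ t ∈ U, 0 < γ t ∧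
      γ t ^ 3 + γ t ^ 2 * ((∑ l, (X : ℝ[X]) ^ d l • (S l).map Polynomial.C) (Sum.inl 0) (Sum.inl 0) + (∑ l, (X : ℝ[X]) ^ d l • (S l).map Polynomial.C) (Sum.inl 1) (Sum.inl 1) + (∑ l, (X : ℝ[X]) ^ d l • (S l).map Polynomial.C) (Sum.inl 2) (Sum.inl 2)).eval t + γ t * ((∑ l, (X : ℝ[X]) ^ d l • (S l).map Polynomial.C) (Sum.inl 0) (Sum.inl 0) * (∑ l, (X : ℝ[X]) ^ d l • (S l).map Polynomial.C) (Sum.inl 1) (Sum.inl 1) - (∑ l, (X : ℝ[X]) ^ d l • (S l).map Polynomial.C) (Sum.inl 0) (Sum.inl 1) * (∑ l, (X : ℝ[X]) ^ d l • (S l).map Polynomial.C) (Sum.inl 1) (Sum.inl 0) + (∑ l, (X : ℝ[X]) ^ d l • (S l).map Polynomial.C) (Sum.inl 0) (Sum.inl 0) * (∑ l, (X : ℝ[X]) ^ d l • (S l).map Polynomial.C) (Sum.inl 2) (Sum.inl 2) - (∑ l, (X : ℝ[X]) ^ d l • (S l).map Polynomial.C) (Sum.inl 0) (Sum.inl 2)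 * (∑ l, (X : ℝ[X]) ^ d l • (S l).map Polynomial.C) (Sum.inl 2) (Sum.inl 0) + (∑ l, (X : ℝ[X]) ^ d l • (S l).map Polynomial.C) (Sum.inl 1) (Sum.inl 1) * (∑ l, (X : ℝ[X]) ^ d l • (S l).map Polynomial.C) (Sum.inl 2) (Sum.inl 2) - (∑ l, (X : ℝ[X]) ^ d l • (S l).map Polynomial.C) (Sum.inl 1) (Sum.inl 2) * (∑ l, (X : ℝ[X]) ^ d l • (S l).map Polynomial.C) (Sum.inl 2) (Sum.inl 1)).eval t + ((∑ l, (X : ℝ[X]) ^ d l • (S l).map Polynomial.C) (Sum.inl 0) (Sum.inl 0) * (∑ l, (X : ℝ[X]) ^ d l • (S l).map Polynomial.C) (Sum.inl 1) (Sum.inl 1) * (∑ l, (X : ℝ[X]) ^ d l • (S l).map Polynomial.C) (Sum.inl 2) (Sum.inl 2) - (∑ l, (X : ℝ[X]) ^ d l • (S l).map Polynomial.C) (Sum.inl 0) (Sum.inl 0) * (∑ l, (X : ℝ[X]) ^ d l • (S l).map Polynomial.C) (Sum.inl 1) (Sum.inl 2) * (∑ l, (X : ℝ[X]) ^ d l •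 (S l).map Polynomial.C) (Sum.inl 2) (Sum.inl 1) - (∑ l, (X : ℝ[X]) ^ d l • (S l).map Polynomial.C) (Sum.inl 0) (Sum.inl 1) * (∑ l, (X : ℝ[X]) ^ d l • (S l).map Polynomial.C) (Sum.inl 1) (Sum.inl 0) * (∑ l, (X : ℝ[X]) ^ d l • (S l).map Polynomial.C) (Sum.inl 2) (Sum.inl 2) + (∑ l, (X : ℝ[X]) ^ d l • (S l).map Polynomial.C) (Sum.inl 0) (Sum.inl 1) * (∑ l, (X : ℝ[X]) ^ d l • (S l).map Polynomial.C) (Sum.inl 1) (Sum.inl 2) * (∑ l, (X : ℝ[X]) ^ d l • (S l).map Polynomial.C) (Sum.inl 2) (Sum.inl 0) + (∑ l, (X : ℝ[X]) ^ d l • (S l).map Polynomial.C) (Sum.inl 0) (Sum.inl 2) * (∑ l, (X : ℝ[X]) ^ d l • (S l).map Polynomial.C) (Sum.inl 1) (Sum.inl 0) * (∑ l, (X : ℝ[X]) ^ d l • (S l).map Polynomial.C) (Sum.inl 2) (Sum.inl 1) - (∑ l, (X : ℝ[X]) ^ d l • (S l).map Polynomial.C) (Sum.inl 0) (Sum.inl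 2) * (∑ l, (X : ℝ[X]) ^ d l • (S l).map Polynomial.C) (Sum.inl 1) (Sum.inl 1) * (∑ l, (X : ℝ[X]) ^ d l • (S l).map Polynomial.C) (Sum.inl 2) (Sum.inl 0)).eval t = 0 := by
  classical
  set M : ℝ → Matrix (Fin 3 ⊕ Fin 0) (Fin 3 ⊕ Fin 0) ℝ := fun t => ∑ l, t ^ d l • S l with hM
  have hdet : (M t₀ + b₀ • (1 : Matrix (Fin 3 ⊕ Fin 0) (Fin 3 ⊕ Fin 0) ℝ)).det = 0 := by
    rw [hM]; dsimp only; rw [← cubic_eq_det]; exact hroot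
  obtain ⟨v, hv0, hv⟩ := Matrix.exists_mulVec_eq_zero_iff.2 hdet
  -- the quadratic form `t ↦ vᵀ G(t) v`
  set f : ℝ → ℝ := fun t => v ⬝ᵥ (M t *ᵥ v) with hf
  have hf_eq : f = fun t => ∑ l, t ^ d l * (v ⬝ᵥ (S l *ᵥ v)) := by
    funext t
    rw [hf, hM]
    dsimp only
    rw [Matrix.sum_mulVec, dotProduct_sum]
    refine Finset.sum_congr rfl fun l _ => ?_
    rw [Matrix.smul_mulVec, dotProduct_smul, smul_eq_mul]
  have hf_cont : Continuous f := by
    rw [hf_eq]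
    exact continuous_finsetSum _ fun l _ => (continuous_pow (d l)).mul continuous_const
  have hvv : 0 < v ⬝ᵥ v := by
    have h0 : 0 ≤ v ⬝ᵥ v := by
      have h := dotProduct_star_self_nonneg v
      rwa [star_trivial] at h
    rcases h0.lt_or_eq with h | h
    · exact h
    · exact absurd (dotProduct_self_eq_zero.1 h.symm) hv0
  have hf₀ : f t₀ < 0 := by
    have h1 : M t₀ *ᵥ v = -(b₀ • v) := by
      have h2 : (M t₀ + b₀ • (1 : Matrix (Fin 3 ⊕ Fin 0) (Fin 3 ⊕ Fin 0) ℝ)) *ᵥ v = M t₀ *ᵥ v + b₀ • v := by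
        rw [Matrix.add_mulVec, Matrix.smul_mulVec, Matrix.one_mulVec]
      rw [h2] at hv
      exact eq_neg_of_add_eq_zero_left hv
    show v ⬝ᵥ (M t₀ *ᵥ v) < 0
    rw [h1, dotProduct_neg, dotProduct_smul, smul_eq_mul]
    nlinarith
  -- on `U = {f < 0}` the symmetric matrix `G(t)` has a negative eigenvalue
  have hex : ∀ t ∈ {t : ℝ | f t < 0}, ∃ b : ℝ, 0 < b ∧
      b ^ 3 + b ^ 2 * ((∑ l, (X : ℝ[X]) ^ d l • (S l).map Polynomial.C) (Sum.inl 0) (Sum.inl 0) + (∑ l, (X : ℝ[X]) ^ d l • (S l).map Polynomial.C) (Sum.inl 1) (Sum.inl 1) + (∑ l, (X : ℝ[X]) ^ d l • (S l).map Polynomial.C) (Sum.inl 2) (Sum.inl 2)).eval t + b * ((∑ l, (X : ℝ[X]) ^ d l • (S l).map Polynomial.C) (Sum.inl 0) (Sum.inl 0) * (∑ l, (X : ℝ[X]) ^ d l • (S l).map Polynomial.C) (Sum.inl 1) (Sum.inl 1) - (∑ l, (X : ℝ[X]) ^ d l • (S l).map Polynomial.C) (Sum.inl 0) (Sum.inl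 1) * (∑ l, (X : ℝ[X]) ^ d l • (S l).map Polynomial.C) (Sum.inl 1) (Sum.inl 0) + (∑ l, (X : ℝ[X]) ^ d l • (S l).map Polynomial.C) (Sum.inl 0) (Sum.inl 0) * (∑ l, (X : ℝ[X]) ^ d l • (S l).map Polynomial.C) (Sum.inl 2) (Sum.inl 2) - (∑ l, (X : ℝ[X]) ^ d l • (S l).map Polynomial.C) (Sum.inl 0) (Sum.inl 2) * (∑ l, (X : ℝ[X]) ^ d l • (S l).map Polynomial.C) (Sum.inl 2) (Sum.inl 0) + (∑ l, (X : ℝ[X]) ^ d l • (S l).map Polynomial.C) (Sum.inl 1) (Sum.inl 1) * (∑ l, (X : ℝ[X]) ^ d l • (S l).map Polynomial.C) (Sum.inl 2) (Sum.inl 2) - (∑ l, (X : ℝ[X]) ^ d l • (S l).map Polynomial.C) (Sum.inl 1) (Sum.inl 2) * (∑ l, (X : ℝ[X]) ^ d l • (S l).map Polynomial.C) (Sum.inl 2) (Sum.inl 1)).eval t + ((∑ l, (X : ℝ[X]) ^ d l • (S l).map Polynomial.C) (Sum.inl 0) (Sum.inl 0) * (∑ l, (X : ℝ[X]) ^ d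 l • (S l).map Polynomial.C) (Sum.inl 1) (Sum.inl 1) * (∑ l, (X : ℝ[X]) ^ d l • (S l).map Polynomial.C) (Sum.inl 2) (Sum.inl 2) - (∑ l, (X : ℝ[X]) ^ d l • (S l).map Polynomial.C) (Sum.inl 0) (Sum.inl 0) * (∑ l, (X : ℝ[X]) ^ d l • (S l).map Polynomial.C) (Sum.inl 1) (Sum.inl 2) * (∑ l, (X : ℝ[X]) ^ d l • (S l).map Polynomial.C) (Sum.inl 2) (Sum.inl 1) - (∑ l, (X : ℝ[X]) ^ d l • (S l).map Polynomial.C) (Sum.inl 0) (Sum.inl 1) * (∑ l, (X : ℝ[X]) ^ d l • (S l).map Polynomial.C) (Sum.inl 1) (Sum.inl 0) * (∑ l, (X : ℝ[X]) ^ d l • (S l).map Polynomial.C) (Sum.inl 2) (Sum.inl 2) + (∑ l, (X : ℝ[X]) ^ d l • (S l).map Polynomial.C) (Sum.inl 0) (Sum.inl 1) * (∑ l, (X : ℝ[X]) ^ d l • (S l).map Polynomial.C) (Sum.inl 1) (Sum.inl 2) * (∑ l, (X : ℝ[X]) ^ d l • (S l).map Polynomial.C) (Sum.inl 2) (Sum.inl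 0) + (∑ l, (X : ℝ[X]) ^ d l • (S l).map Polynomial.C) (Sum.inl 0) (Sum.inl 2) * (∑ l, (X : ℝ[X]) ^ d l • (S l).map Polynomial.C) (Sum.inl 1) (Sum.inl 0) * (∑ l, (X : ℝ[X]) ^ d l • (S l).map Polynomial.C) (Sum.inl 2) (Sum.inl 1) - (∑ l, (X : ℝ[X]) ^ d l • (S l).map Polynomial.C) (Sum.inl 0) (Sum.inl 2) * (∑ l, (X : ℝ[X]) ^ d l • (S l).map Polynomial.C) (Sum.inl 1) (Sum.inl 1) * (∑ l, (X : ℝ[X]) ^ d l • (S l).map Polynomial.C) (Sum.inl 2) (Sum.inl 0)).eval t = 0 := by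
    intro t ht
    have hH : (M t).IsHermitian := Matrix.isHermitian_iff_isSymm.2 (isSymm_pencil K d S hS t)
    have hnot : ¬ (M t).PosSemidef := by
      intro hpsd
      have h := hpsd.dotProduct_mulVec_nonneg v
      rw [star_trivial] at h
      exact absurd ht (not_lt.2 h)
    rw [hH.posSemidef_iff_eigenvalues_nonneg] at hnot
    obtain ⟨i, hi⟩ : ∃ i, hH.eigenvalues i < 0 := by
      simpa [Pi.le_def] using hnot
    refine ⟨-hH.eigenvalues i, by linarith, ?_⟩
    rw [cubic_eq_det]
    apply Matrix.exists_mulVec_eq_zero_iff.1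
    refine ⟨⇑(hH.eigenvectorBasis i), (WithLp.ofLp_eq_zero 2).ne.2 <| hH.eigenvectorBasis.orthonormal.ne_zero i, ?_⟩
    rw [Matrix.add_mulVec, hH.mulVec_eigenvectorBasis i, Matrix.smul_mulVec, Matrix.one_mulVec, neg_smul,
      add_neg_cancel]
  refine ⟨{t : ℝ | f t < 0}, isOpen_lt hf_cont continuous_const, hf₀,
    fun t => if h : ∃ b : ℝ, 0 < b ∧ b ^ 3 + b ^ 2 * ((∑ l, (X : ℝ[X]) ^ d l • (S l).map Polynomial.C) (Sum.inl 0) (Sum.inl 0) + (∑ l, (X : ℝ[X]) ^ d l • (S l).map Polynomial.C) (Sum.inl 1) (Sum.inl 1) + (∑ l, (X : ℝ[X]) ^ d l • (S l).map Polynomial.C) (Sum.inl 2) (Sum.inl 2)).eval t + b * ((∑ l, (X : ℝ[X]) ^ d l • (S l).map Polynomial.C) (Sum.inl 0) (Sum.inl 0) * (∑ l, (X : ℝ[X]) ^ d l • (S l).map Polynomial.C) (Sum.inl 1) (Sum.inl 1) - (∑ l, (X : ℝ[X]) ^ d l • (S l).map Polynomial.C) (Sum.inl 0) (Sum.inl 1)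 * (∑ l, (X : ℝ[X]) ^ d l • (S l).map Polynomial.C) (Sum.inl 1) (Sum.inl 0) + (∑ l, (X : ℝ[X]) ^ d l • (S l).map Polynomial.C) (Sum.inl 0) (Sum.inl 0) * (∑ l, (X : ℝ[X]) ^ d l • (S l).map Polynomial.C) (Sum.inl 2) (Sum.inl 2) - (∑ l, (X : ℝ[X]) ^ d l • (S l).map Polynomial.C) (Sum.inl 0) (Sum.inl 2) * (∑ l, (X : ℝ[X]) ^ d l • (S l).map Polynomial.C) (Sum.inl 2) (Sum.inl 0) + (∑ l, (X : ℝ[X]) ^ d l • (S l).map Polynomial.C) (Sum.inl 1) (Sum.inl 1) * (∑ l, (X : ℝ[X]) ^ d l • (S l).map Polynomial.C) (Sum.inl 2) (Sum.inl 2) - (∑ l, (X : ℝ[X]) ^ d l • (S l).map Polynomial.C) (Sum.inl 1) (Sum.inl 2) * (∑ l, (X : ℝ[X]) ^ d l • (S l).map Polynomial.C) (Sum.inl 2) (Sum.inl 1)).eval t + ((∑ l, (X : ℝ[X]) ^ d l • (S l).map Polynomial.C) (Sum.inl 0) (Sum.inl 0) * (∑ l, (X : ℝ[X]) ^ d l •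 (S l).map Polynomial.C) (Sum.inl 1) (Sum.inl 1) * (∑ l, (X : ℝ[X]) ^ d l • (S l).map Polynomial.C) (Sum.inl 2) (Sum.inl 2) - (∑ l, (X : ℝ[X]) ^ d l • (S l).map Polynomial.C) (Sum.inl 0) (Sum.inl 0) * (∑ l, (X : ℝ[X]) ^ d l • (S l).map Polynomial.C) (Sum.inl 1) (Sum.inl 2) * (∑ l, (X : ℝ[X]) ^ d l • (S l).map Polynomial.C) (Sum.inl 2) (Sum.inl 1) - (∑ l, (X : ℝ[X]) ^ d l • (S l).map Polynomial.C) (Sum.inl 0) (Sum.inl 1) * (∑ l, (X : ℝ[X]) ^ d l • (S l).map Polynomial.C) (Sum.inl 1) (Sum.inl 0) * (∑ l, (X : ℝ[X]) ^ d l • (S l).map Polynomial.C) (Sum.inl 2) (Sum.inl 2) + (∑ l, (X : ℝ[X]) ^ d l • (S l).map Polynomial.C) (Sum.inl 0) (Sum.inl 1) * (∑ l, (X : ℝ[X]) ^ d l • (S l).map Polynomial.C) (Sum.inl 1) (Sum.inl 2) * (∑ l, (X : ℝ[X]) ^ d l • (S l).map Polynomial.C) (Sum.inl 2) (Sum.inl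 0) + (∑ l, (X : ℝ[X]) ^ d l • (S l).map Polynomial.C) (Sum.inl 0) (Sum.inl 2) * (∑ l, (X : ℝ[X]) ^ d l • (S l).map Polynomial.C) (Sum.inl 1) (Sum.inl 0) * (∑ l, (X : ℝ[X]) ^ d l • (S l).map Polynomial.C) (Sum.inl 2) (Sum.inl 1) - (∑ l, (X : ℝ[X]) ^ d l • (S l).map Polynomial.C) (Sum.inl 0) (Sum.inl 2) * (∑ l, (X : ℝ[X]) ^ d l • (S l).map Polynomial.C) (Sum.inl 1) (Sum.inl 1) * (∑ l, (X : ℝ[X]) ^ d l • (S l).map Polynomial.C) (Sum.inl 2) (Sum.inl 0)).eval t = 0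
      then h.choose else 0, ?_⟩
  intro t ht
  dsimp only
  rw [dif_pos (hex t ht)]
  exact (hex t ht).choose_spec

end OsculationThreeK

end Summit.ValiantsHypothesis.ValiantsHypothesis.Theorems.LacunarySymmetroidMatrixDescartes
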